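import Summits.ABC.StewartYu.RecordExits
import HarnessLib

/-!
# Cell abc-stewartyu, Gen-3 frames (cruxes `Y07Odd`/`Y07Two`): the RECORD's exit C — the zero estimate's
# inequality bounds every `r × r` minor, so clause (C) of `RecordTwo`/`RecordOdd` is matrix-free

`Summits/ABC/StewartYu/RecordExitC.lean` — cell `abc-stewartyu` (HOME `run/shared/lean/pub/abc-stewartyu/`),
route `PadicPrimesKummerThird`, seat p4 (g3), engine-support seat; sequel of `RecordExits.lean`.
Theorems only, place-free.

Clause (C) of `GenThreeFrameSpecTwo.RecordTwo` / `GenThreeFrameSpecOdd.RecordOdd` asks, for `0 < r < n`,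
`d₀ ≤ 1`, every `r × n` integer matrix `M` with independent rows satisfying the exit-C inequality
`choose(S₀+(r−d₀), r−d₀)·(2X+1)·nesterenkoH n r d₀ M D₀ D ≤ (n+1)!·2ⁿ·D₀·∏ Dⱼ`, and every injective
column selection `κ` with `det M_κ ≠ 0`, the (5.22) cost line in the quantity
`P(κ) = (r!)²·nʳ·|det M_κ|·∏ᵢ V(κ i)`.  This file removes the matrix:

* `natAbs_det_cols_eq_absMinor` — `|det (M_{j, κ i})_{i,j}| = absMinor M (image κ)` for injective `κ`
  (sort the columns: a permutation of `Fin r`, `Matrix.det_permute'`);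
* `exitC_det_le` — the exit inequality (any binomial index `ℓ`) gives, for EVERY injective `κ`,
  `choose(S₀+ℓ,ℓ)·(2X+1)·(d₀+n−r)!·2^{n−r}·D₀^{d₀}·|det M_κ| ≤ (n+1)!·2ⁿ·D₀·∏ᵢ D(κ i)` (one term of the
  minors sum; `∏_{j∉I} Dⱼ ≥ 1` cancelled) — no independence needed;
* `exitC_det_weighted_le` — with the Matveev box `Dⱼ·Vⱼ ≤ Λ` (`Vⱼ ≥ 0`):
  `choose·(2X+1)·(d₀+n−r)!·2^{n−r}·D₀^{d₀}·(|det M_κ|·∏ᵢ V(κ i)) ≤ (n+1)!·2ⁿ·D₀·Λʳ`, i.e.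
  `P(κ) ≤ Pmax := (r!)²nʳ·(n+1)!·2ⁿ·D₀·Λʳ / (choose·(2X+1)·(d₀+n−r)!·2^{n−r}·D₀^{d₀})` (`P_le_Pmax`);
* `mul_log_mono` — `P ↦ P·(w + log P + log 2P)` is monotone on `[1, ∞)` for `w ≥ 0`;

so that the record proves clause (C) from ONE scalar inequality with `P` replaced by `Pmax`
(`RecordAssembly.lean`).

WHAT THIS IS NOT: no choice of parameters, no numerics (the record's); no crux moves.

References: Yu. V. Nesterenko, LNM 1819 (2003), §5.2 (5.13), (5.19)–(5.22) (p. 103: "`|det M_I| A_I ≤ …`").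
-/

open Finset
open Literature.NumberTheory.Transcendental
open Literature.NumberTheory.Transcendental.GaGm

namespace Summit.ABC.StewartYu.RecordExits

variable {n r : ℕ}

/-! ### Column selections versus `absMinor` -/

/-- **An injective column selection is a sorted one up to a permutation**: for injective
`κ : Fin r → Fin n` there is a permutation `σ` of `Fin r` with `κ ∘ σ` = the increasing enumeration of
`image κ`. [folklore] -/
theorem exists_perm_comp_eq_orderEmbOfFin (κ : Fin r → Fin n) (hκ : Function.Injective κ) :
    ∃ (h : (univ.image κ).card = r) (σ : Equiv.Perm (Fin r)),
      ∀ k, κ (σ k) = (univ.image κ).orderEmbOfFin h k := by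
  classical
  have hcard : (univ.image κ).card = r := by
    rw [Finset.card_image_of_injective _ hκ, Finset.card_univ, Fintype.card_fin]
  refine ⟨hcard, ?_⟩
  set e := (univ.image κ).orderEmbOfFin hcard with he
  have hmem : ∀ k, ∃ i, κ i = e k := by
    intro k
    have hk : e k ∈ univ.image κ := Finset.orderEmbOfFin_mem _ hcard k
    obtain ⟨i, -, hi⟩ := Finset.mem_image.mp hk
    exact ⟨i, hi⟩
  choose σ hσ using hmem
  have hσinj : Function.Injective σ := by
    intro k k' hkk'
    have : e k = e k' := by rw [← hσ k, ← hσ k', hkk']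
    exact e.injective this
  have hσbij : Function.Bijective σ := (Finite.injective_iff_bijective).mp hσinj
  refine ⟨Equiv.ofBijective σ hσbij, fun k => ?_⟩
  exact hσ k

/-- **`|det (M_{j, κ i})_{i,j}| = absMinor M (image κ)`** for an injective column selection `κ`
(the matrix of clause (C) is the transpose of the column submatrix; sorting the columns changes the
determinant by a sign). [cite: Nesterenko2003, §5.1 (5.7)] -/
theorem natAbs_det_cols_eq_absMinor (M : Matrix (Fin r) (Fin n) ℤ) (κ : Fin r → Fin n)
    (hκ : Function.Injective κ) :
    ((Matrix.of fun i j => M j (κ i)).det).natAbs = absMinor M (univ.image κ) := by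
  classical
  obtain ⟨hcard, σ, hσ⟩ := exists_perm_comp_eq_orderEmbOfFin κ hκ
  -- the clause-(C) matrix is the transpose of the column submatrix
  have htr : (Matrix.of fun i j => M j (κ i)) = (M.submatrix id κ).transpose := by
    ext i j; rfl
  rw [htr, Matrix.det_transpose, absMinor, dif_pos hcard]
  -- sorted selection = `κ ∘ σ`
  have hsub : (M.submatrix id fun k => (univ.image κ).orderEmbOfFin hcard k) =
      (M.submatrix id κ).submatrix id σ := by
    ext i k
    simp only [Matrix.submatrix_apply, id_eq]
    rw [← hσ k]
  rw [hsub, Matrix.det_permute', Int.natAbs_mul]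
  rcases Int.units_eq_one_or (Equiv.Perm.sign σ) with h1 | h1 <;> simp [h1]

/-! ### Exit C bounds every minor -/

/-- **The exit inequality bounds every `r × r` minor** (any binomial index `ℓ`): for EVERY injective `κ`,
`choose(S₀+ℓ,ℓ)·(2X+1)·(d₀+n−r)!·2^{n−r}·D₀^{d₀}·|det M_κ| ≤ (n+1)!·2ⁿ·D₀·∏ᵢ D(κ i)` — the term
`I = image κ` of the minors sum, with `∏_{j∉I} Dⱼ ≥ 1` cancelled. No independence needed.
[cite: Nesterenko2003, §5.2 (5.13)] -/
theorem exitC_det_le (M : Matrix (Fin r) (Fin n) ℤ) {D : Fin n → ℕ} (hD1 : ∀ j, 1 ≤ D j)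
    {d₀ D₀ S₀ X ℓ : ℕ}
    (h : Nat.choose (S₀ + ℓ) ℓ * (2 * X + 1) * nesterenkoH n r d₀ M D₀ D ≤
      (n + 1).factorial * 2 ^ n * D₀ * ∏ j, D j)
    (κ : Fin r → Fin n) (hκ : Function.Injective κ) :
    Nat.choose (S₀ + ℓ) ℓ * (2 * X + 1) * ((d₀ + (n - r)).factorial * 2 ^ (n - r) * D₀ ^ d₀) *
        ((Matrix.of fun i j => M j (κ i)).det).natAbs ≤
      (n + 1).factorial * 2 ^ n * D₀ * ∏ i, D (κ i) := by
  classical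
  rw [natAbs_det_cols_eq_absMinor M κ hκ]
  set I : Finset (Fin n) := univ.image κ with hIdef
  have hcard : I.card = r := by
    rw [hIdef, Finset.card_image_of_injective _ hκ, Finset.card_univ, Fintype.card_fin]
  have hI : I ∈ (univ : Finset (Fin n)).powersetCard r :=
    Finset.mem_powersetCard.mpr ⟨Finset.subset_univ _, hcard⟩
  -- one term of the minors sum
  have hterm : (d₀ + (n - r)).factorial * 2 ^ (n - r) * D₀ ^ d₀ * (absMinor M I * ∏ j ∈ univ \ I, D j) ≤
      nesterenkoH n r d₀ M D₀ D := by
    unfold nesterenkoH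
    exact Nat.mul_le_mul_left _
      (Finset.single_le_sum (f := fun J => absMinor M J * ∏ j ∈ univ \ J, D j) (fun J _ => Nat.zero_le _) hI)
  have hsplit : ∏ j, D j = (∏ i ∈ I, D i) * ∏ j ∈ univ \ I, D j := by
    rw [← Finset.prod_union (Finset.disjoint_sdiff), Finset.union_sdiff_of_subset (Finset.subset_univ _)]
  have hQ : 0 < ∏ j ∈ univ \ I, D j := Finset.prod_pos fun j _ => hD1 j
  have hprodI : ∏ i ∈ I, D i = ∏ i, D (κ i) := by
    rw [hIdef, Finset.prod_image fun x _ y _ hxy => hκ hxy]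
  have h1 : Nat.choose (S₀ + ℓ) ℓ * (2 * X + 1) * ((d₀ + (n - r)).factorial * 2 ^ (n - r) * D₀ ^ d₀) *
        absMinor M I * ∏ j ∈ univ \ I, D j ≤
      (n + 1).factorial * 2 ^ n * D₀ * (∏ i ∈ I, D i) * ∏ j ∈ univ \ I, D j := by
    calc Nat.choose (S₀ + ℓ) ℓ * (2 * X + 1) * ((d₀ + (n - r)).factorial * 2 ^ (n - r) * D₀ ^ d₀) *
          absMinor M I * ∏ j ∈ univ \ I, D j
        = Nat.choose (S₀ + ℓ) ℓ * (2 * X + 1) *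
          ((d₀ + (n - r)).factorial * 2 ^ (n - r) * D₀ ^ d₀ * (absMinor M I * ∏ j ∈ univ \ I, D j)) := by
          ring
      _ ≤ Nat.choose (S₀ + ℓ) ℓ * (2 * X + 1) * nesterenkoH n r d₀ M D₀ D := Nat.mul_le_mul_left _ hterm
      _ ≤ (n + 1).factorial * 2 ^ n * D₀ * ∏ j, D j := h
      _ = (n + 1).factorial * 2 ^ n * D₀ * (∏ i ∈ I, D i) * ∏ j ∈ univ \ I, D j := by
          rw [hsplit]; ring
  have h2 := Nat.le_of_mul_le_mul_right h1 hQ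
  rwa [hprodI] at h2

/-- The real determinant of the clause-(C) matrix is the cast of the integer one; its absolute value is
the cast of `natAbs`. [folklore] -/
theorem abs_det_cols_cast (M : Matrix (Fin r) (Fin n) ℤ) (κ : Fin r → Fin n) :
    |(Matrix.of fun i j => (M j (κ i) : ℝ)).det| =
      (((Matrix.of fun i j => M j (κ i)).det).natAbs : ℝ) := by
  have h1 : (Matrix.of fun i j => (M j (κ i) : ℝ)) =
      (Matrix.of fun i j => M j (κ i)).map (Int.castRingHom ℝ) := by
    ext i j; simp
  rw [h1, Summit.ABC.StewartYu.MatveevLever.det_map_castRingHom, Nat.cast_natAbs, Int.cast_abs]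

/-- A non-singular clause-(C) matrix has `|det| ≥ 1`. [folklore] -/
theorem one_le_abs_det_cols (M : Matrix (Fin r) (Fin n) ℤ) (κ : Fin r → Fin n)
    (hdet : (Matrix.of fun i j => (M j (κ i) : ℝ)).det ≠ 0) :
    1 ≤ |(Matrix.of fun i j => (M j (κ i) : ℝ)).det| := by
  rw [abs_det_cols_cast]
  have hz : ((Matrix.of fun i j => M j (κ i)).det) ≠ 0 := by
    intro h0
    apply hdet
    rw [← abs_eq_zero, abs_det_cols_cast, h0]
    simp
  have : 1 ≤ ((Matrix.of fun i j => M j (κ i)).det).natAbs := Int.natAbs_pos.mpr hz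
  exact_mod_cast this

/-- **Exit C with the Matveev box**: if moreover `Dⱼ·Vⱼ ≤ Λ` (`Vⱼ ≥ 0`), then for every
injective `κ`:
`choose(S₀+ℓ,ℓ)·(2X+1)·(d₀+n−r)!·2^{n−r}·D₀^{d₀}·(|det M_κ|·∏ᵢ V(κ i)) ≤ (n+1)!·2ⁿ·D₀·Λʳ`.
[cite: Nesterenko2003, §5.2 (5.21)–(5.22)] -/
theorem exitC_det_weighted_le (M : Matrix (Fin r) (Fin n) ℤ) {D : Fin n → ℕ} (hD1 : ∀ j, 1 ≤ D j)
    {V : Fin n → ℝ} (hV0 : ∀ j, 0 ≤ V j) {Λ : ℝ} (hΛ : ∀ j, (D j : ℝ) * V j ≤ Λ)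
    {d₀ D₀ S₀ X ℓ : ℕ}
    (h : Nat.choose (S₀ + ℓ) ℓ * (2 * X + 1) * nesterenkoH n r d₀ M D₀ D ≤
      (n + 1).factorial * 2 ^ n * D₀ * ∏ j, D j)
    (κ : Fin r → Fin n) (hκ : Function.Injective κ) :
    ((Nat.choose (S₀ + ℓ) ℓ * (2 * X + 1) * ((d₀ + (n - r)).factorial * 2 ^ (n - r) * D₀ ^ d₀) : ℕ) : ℝ) *
        (|(Matrix.of fun i j => (M j (κ i) : ℝ)).det| * ∏ i, V (κ i)) ≤
      (((n + 1).factorial * 2 ^ n * D₀ : ℕ) : ℝ) * Λ ^ r := by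
  have hN := exitC_det_le M hD1 h κ hκ
  set c : ℝ := ((Nat.choose (S₀ + ℓ) ℓ * (2 * X + 1) *
      ((d₀ + (n - r)).factorial * 2 ^ (n - r) * D₀ ^ d₀) : ℕ) : ℝ) with hc
  set B : ℝ := (((n + 1).factorial * 2 ^ n * D₀ : ℕ) : ℝ) with hB
  have hR : c * (((Matrix.of fun i j => M j (κ i)).det).natAbs : ℝ) ≤ B * ∏ i, (D (κ i) : ℝ) := by
    have := (Nat.cast_le (α := ℝ)).mpr hN
    rw [hc, hB]
    push_cast at this ⊢
    linarith
  have hprodV : 0 ≤ ∏ i, V (κ i) := Finset.prod_nonneg fun i _ => hV0 _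
  have hB0 : 0 ≤ B := by rw [hB]; exact Nat.cast_nonneg _
  have hDV : ∏ i, ((D (κ i) : ℝ) * V (κ i)) ≤ Λ ^ r := by
    calc ∏ i, ((D (κ i) : ℝ) * V (κ i)) ≤ ∏ _i : Fin r, Λ :=
          Finset.prod_le_prod (fun i _ => mul_nonneg (Nat.cast_nonneg _) (hV0 _)) fun i _ => hΛ _
      _ = Λ ^ r := by rw [Finset.prod_const, Finset.card_univ, Fintype.card_fin]
  rw [abs_det_cols_cast]
  calc c * ((((Matrix.of fun i j => M j (κ i)).det).natAbs : ℝ) * ∏ i, V (κ i))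
      = (c * (((Matrix.of fun i j => M j (κ i)).det).natAbs : ℝ)) * ∏ i, V (κ i) := by ring
    _ ≤ (B * ∏ i, (D (κ i) : ℝ)) * ∏ i, V (κ i) := mul_le_mul_of_nonneg_right hR hprodV
    _ = B * ∏ i, ((D (κ i) : ℝ) * V (κ i)) := by rw [mul_assoc, ← Finset.prod_mul_distrib]
    _ ≤ B * Λ ^ r := mul_le_mul_of_nonneg_left hDV hB0

/-- **`P(κ) ≤ Pmax`**: the quantity of the (5.22) line, `P(κ) = (r!)²·nʳ·|det M_κ|·∏ᵢ V(κ i)`, is at most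
`Pmax = (r!)²·nʳ·((n+1)!·2ⁿ·D₀·Λʳ) / (choose(S₀+ℓ,ℓ)·(2X+1)·(d₀+n−r)!·2^{n−r}·D₀^{d₀})` for every
injective `κ`, whenever the exit inequality holds (`Dⱼ ≥ 1`, `1 ≤ D₀`, `Dⱼ·Vⱼ ≤ Λ`).
[cite: Nesterenko2003, §5.2 (5.21)–(5.22)] -/
theorem P_le_Pmax (M : Matrix (Fin r) (Fin n) ℤ) {D : Fin n → ℕ} (hD1 : ∀ j, 1 ≤ D j)
    {V : Fin n → ℝ} (hV0 : ∀ j, 0 ≤ V j) {Λ : ℝ} (hΛ : ∀ j, (D j : ℝ) * V j ≤ Λ)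
    {d₀ D₀ S₀ X ℓ : ℕ} (hD₀ : 1 ≤ D₀)
    (h : Nat.choose (S₀ + ℓ) ℓ * (2 * X + 1) * nesterenkoH n r d₀ M D₀ D ≤
      (n + 1).factorial * 2 ^ n * D₀ * ∏ j, D j)
    (κ : Fin r → Fin n) (hκ : Function.Injective κ) :
    ((r.factorial : ℝ)) ^ 2 * (n : ℝ) ^ r *
        (|(Matrix.of fun i j => (M j (κ i) : ℝ)).det| * ∏ i, V (κ i)) ≤
      ((r.factorial : ℝ)) ^ 2 * (n : ℝ) ^ r *
        ((((n + 1).factorial * 2 ^ n * D₀ : ℕ) : ℝ) * Λ ^ r /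
          ((Nat.choose (S₀ + ℓ) ℓ * (2 * X + 1) *
            ((d₀ + (n - r)).factorial * 2 ^ (n - r) * D₀ ^ d₀) : ℕ) : ℝ)) := by
  have hw := exitC_det_weighted_le M hD1 hV0 hΛ h κ hκ
  have hcpos : (0 : ℝ) < ((Nat.choose (S₀ + ℓ) ℓ * (2 * X + 1) *
      ((d₀ + (n - r)).factorial * 2 ^ (n - r) * D₀ ^ d₀) : ℕ) : ℝ) := by
    have h1 : 0 < Nat.choose (S₀ + ℓ) ℓ := Nat.choose_pos (Nat.le_add_left _ _)
    have h2 : 0 < (d₀ + (n - r)).factorial := Nat.factorial_pos _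
    have h3 : 0 < D₀ ^ d₀ := pow_pos hD₀ _
    positivity
  refine mul_le_mul_of_nonneg_left ?_ (by positivity)
  rw [le_div_iff₀ hcpos, mul_comm]
  exact hw

/-! ### Monotonicity of the (5.22) left-hand side in `P` -/

/-- `P ↦ P·(w + log P + log 2P)` is monotone on `[1, ∞)` for `w ≥ 0` (the `p = 2` clause).
[folklore] -/
theorem mul_log_mono {w P Q : ℝ} (hw : 0 ≤ w) (hP : 1 ≤ P) (hPQ : P ≤ Q) :
    P * (w + Real.log P + Real.log (2 * P)) ≤ Q * (w + Real.log Q + Real.log (2 * Q)) := by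
  have hP0 : 0 < P := by linarith
  have hQ1 : 1 ≤ Q := hP.trans hPQ
  have hlogP : 0 ≤ Real.log P := Real.log_nonneg hP
  have hlog2P : 0 ≤ Real.log (2 * P) := Real.log_nonneg (by linarith)
  have hlogPQ : Real.log P ≤ Real.log Q := Real.log_le_log hP0 hPQ
  have hlog2PQ : Real.log (2 * P) ≤ Real.log (2 * Q) := Real.log_le_log (by linarith) (by linarith)
  calc P * (w + Real.log P + Real.log (2 * P)) ≤ Q * (w + Real.log P + Real.log (2 * P)) :=
        mul_le_mul_of_nonneg_right hPQ (by linarith)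
    _ ≤ Q * (w + Real.log Q + Real.log (2 * Q)) :=
        mul_le_mul_of_nonneg_left (by linarith) (by linarith)

/-- `P ↦ P·(w + log P + E + log 2P)` is monotone on `[1, ∞)` for `w, E ≥ 0` (the odd-`p` clause,
`E = log p`). [folklore] -/
theorem mul_log_mono' {w E P Q : ℝ} (hw : 0 ≤ w) (hE : 0 ≤ E) (hP : 1 ≤ P) (hPQ : P ≤ Q) :
    P * (w + Real.log P + E + Real.log (2 * P)) ≤ Q * (w + Real.log Q + E + Real.log (2 * Q)) := by
  have hP0 : 0 < P := by linarith
  have hlogP : 0 ≤ Real.log P := Real.log_nonneg hP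
  have hlog2P : 0 ≤ Real.log (2 * P) := Real.log_nonneg (by linarith)
  have hlogPQ : Real.log P ≤ Real.log Q := Real.log_le_log hP0 hPQ
  have hlog2PQ : Real.log (2 * P) ≤ Real.log (2 * Q) := Real.log_le_log (by linarith) (by linarith)
  calc P * (w + Real.log P + E + Real.log (2 * P)) ≤ Q * (w + Real.log P + E + Real.log (2 * P)) :=
        mul_le_mul_of_nonneg_right hPQ (by linarith)
    _ ≤ Q * (w + Real.log Q + E + Real.log (2 * Q)) :=
        mul_le_mul_of_nonneg_left (by linarith) (by linarith)

/-- **`1 ≤ P(κ)`** for a non-singular selection when `Vⱼ ≥ 1` (`|det M_κ| ≥ 1`, `r!, n ≥ 1`).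
[folklore] -/
theorem one_le_P (hn : 1 ≤ n) (M : Matrix (Fin r) (Fin n) ℤ) {V : Fin n → ℝ} (hV1 : ∀ j, 1 ≤ V j)
    (κ : Fin r → Fin n) (hdet : (Matrix.of fun i j => (M j (κ i) : ℝ)).det ≠ 0) :
    1 ≤ ((r.factorial : ℝ)) ^ 2 * (n : ℝ) ^ r *
        (|(Matrix.of fun i j => (M j (κ i) : ℝ)).det| * ∏ i, V (κ i)) := by
  have h1 : (1 : ℝ) ≤ (r.factorial : ℝ) := by exact_mod_cast Nat.one_le_iff_ne_zero.mpr (Nat.factorial_ne_zero r)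
  have h2 : (1 : ℝ) ≤ (n : ℝ) := by exact_mod_cast hn
  have h3 := one_le_abs_det_cols M κ hdet
  have h4 : 1 ≤ ∏ i, V (κ i) := Finset.one_le_prod fun i _ => hV1 _
  have h12 : (1 : ℝ) ≤ ((r.factorial : ℝ)) ^ 2 * (n : ℝ) ^ r :=
    one_le_mul_of_one_le_of_one_le (one_le_pow₀ h1) (one_le_pow₀ h2)
  have h34 : (1 : ℝ) ≤ |(Matrix.of fun i j => (M j (κ i) : ℝ)).det| * ∏ i, V (κ i) :=
    one_le_mul_of_one_le_of_one_le h3 h4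
  exact one_le_mul_of_one_le_of_one_le h12 h34

end Summit.ABC.StewartYu.RecordExits
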